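import Summits.KontsevichZagierPeriods.Zeta5Search.Barrier.ConeGammaCuspSlopeHomogeneous

/-!
# ζ(5) search — BARRIER: THE LATTICE GAP — at rational flip times `L·K_b`, `L·R_b`, `L·E`, `L·σ` are integers;
at a local maximiser of the MODEL `γ` either `σ(δ) = 0` or `σ(δ) ≤ −1/L`

HONEST FRAMING (cell `pub-zeta5`): systematic search; no irrationality claim unless kernel-certified. MODEL objects
under Brown–Zudilin's (28)+(30) accounting ([BZ22] = arXiv:2210.03391; (28) observed, not proved); nothing here is a
statement about `ζ(5)`, any `γ` of record, the cone's supremum (C2 OPEN) or the VALUE / SIGN of the cusp slope at a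
named direction (DATA of the cell); S-E stays CONJECTURED; records in print UNMOVED. Prover P2 g28 (P2 g27's successor
menu (b); plan INBOX 2026-08-27), companion of `ConeGammaCuspSlopeHomogeneous`.

THE LATTICE HYPOTHESIS `hL : ∀ k, ∃ z : ℤ, L * (phiForm δ k / h28 a k) = z` — all 28 member flip times
`c_k = −φ_k(δ)/h_k(a)` lie on the lattice `(1/L)ℤ` (a rational direction and a rational displacement; for INTEGER forms
`h_k(a) = f k ∈ ℤ` and integer `φ_k(δ)`, `L = lcm_k f k` works: `lattice_of_int_forms`). Under it P2 g27's exact forms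
(`germ_pair_exists_intComb`: `K_b = −Σ c_i·j_i`; `cuspSlope_eq_neg_intComb`: `σ = −Σ_b Σ_i c_{b,i}·j_{b,i}`; interior
`c_i ∈ {0} ∪ {flip times}`, `j ∈ ℤ`) give, in one line each:
* **`germ_pair_mul_mem_int`** — `L·K_b(δ) ∈ ℤ` at every `b ∈ bkpts a T`; **`germ_symm_mul_mem_int`** — `L·R_b(δ) ∈ ℤ`;
  `endGerms_mul_mem_int` — `L·E(δ) ∈ ℤ` (the lattice point); **`cuspSlope_mul_mem_int`** — `L·σ(δ) ∈ ℤ`: THE CUSP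
  SLOPE LIVES ON THE LATTICE `(1/L)ℤ`;
* **`cuspSlope_eq_zero_or_le_of_isLocalMax`** — THE GAP: at a Regular OPEN-box local maximiser of the MODEL `γ` with
  `Q > 0` (P2 g23's `cuspSlope_nonpos_of_isLocalMax`) and `0 < L`: `σ(δ) = 0 ∨ σ(δ) ≤ −1/L` — the first DISCRETE
  necessary condition; `endGerms_eq_zero_or_ge` — `E(δ) = 0 ∨ 1/L ≤ E(δ)` (every `δ`, no maximiser needed);
* integer forms: `pairForm_realDir_eq_int` / `phiForm_realDir_eq_int`, `lcm_forms_pos`, **`lattice_of_int_forms`**,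
  **`cuspSlope_mul_lcm_mem_int`** (`(lcm_k f k)·σ(δ) ∈ ℤ` for integer forms and integer `φ(δ)`),
  **`cuspSlope_realDir_mul_lcm_mem_int`** (integer direction `a₀` with positive forms, integer displacement `d`,
  period `1`); rational displacements reduce to these by `cuspSlope_smul`.
DESK (DATA, `HOME/pub-zeta5-p2/g28/alg/lattice.py`, exact, ≈ 40 CPU-s): with `L` = lcm of the denominators of the 28
flip times, `L·K_b ∈ ℤ` at all 22,044 junction × displacement pairs of record/41, flag/60, argmax-120, t*/480 (0
failures) and `L·σ ∈ ℤ` for all 37 displacements, the lattice ATTAINED (den σ = L) in 10 of 37. NOT here (honest): the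
value of `σ` or of `L` at any named direction in the kernel; anything about `γ` of record, C2, S-E, `ζ(5)`.
-/

noncomputable section

open Set MeasureTheory
open scoped Topology

namespace Summit.KontsevichZagierPeriods.Zeta5Search.Barrier.ConeGamma

open Literature.NumberTheory.Irrationality.BrownZudilin2022 (hForm)

/-! ### Integer combinations with lattice coefficients -/

/-- An integer combination `Σ_{0<i<n} c_i·j_i` whose coefficients lie on the lattice (`L·c_i ∈ ℤ`) lies on the
lattice: `L·Σ c_i·j_i ∈ ℤ`. -/
theorem sum_mul_int_of_lattice {n : ℕ} {c : ℕ → ℝ} (j : ℕ → ℤ) {L : ℝ}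
    (hc : ∀ i, 0 < i → i < n → ∃ z : ℤ, L * c i = z) :
    ∃ z : ℤ, L * ∑ i ∈ Finset.Ico 1 n, c i * (j i : ℝ) = z := by
  classical
  have h : ∀ i ∈ Finset.Ico 1 n, ∃ z : ℤ, L * c i = z := fun i hi => by
    rw [Finset.mem_Ico] at hi; exact hc i hi.1 hi.2
  choose! z hz using h
  refine ⟨∑ i ∈ Finset.Ico 1 n, z i * j i, ?_⟩
  rw [Finset.mul_sum]
  push_cast
  refine Finset.sum_congr rfl fun i hi => ?_
  rw [← mul_assoc, hz i hi]

/-- The lattice hypothesis passes to `−δ`. -/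
theorem lattice_neg {a : Dir} {δ : Fin 8 → ℝ} {L : ℝ} (hL : ∀ k : Fin 28, ∃ z : ℤ, L * (phiForm δ k / h28 a k) = z)
    (k : Fin 28) : ∃ z : ℤ, L * (phiForm (-δ) k / h28 a k) = z := by
  obtain ⟨z, hz⟩ := hL k
  exact ⟨-z, by rw [phiForm_neg, neg_div, mul_neg, hz]; push_cast; ring⟩

/-- A canonical interior point (`0` or a flip time) lies on the lattice. -/
theorem lattice_of_interior {a : Dir} {δ : Fin 8 → ℝ} {L : ℝ}
    (hL : ∀ k : Fin 28, ∃ z : ℤ, L * (phiForm δ k / h28 a k) = z) {x : ℝ}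
    (hx : x = 0 ∨ ∃ k : Fin 28, x = -(phiForm δ k / h28 a k)) : ∃ z : ℤ, L * x = z := by
  rcases hx with rfl | ⟨k, rfl⟩
  · exact ⟨0, by simp⟩
  · obtain ⟨z, hz⟩ := hL k
    exact ⟨-z, by rw [mul_neg, hz]; push_cast; ring⟩

/-! ### `L·K_b`, `L·R_b`, `L·E`, `L·σ` are integers -/

/-- **`L·K_b(δ) ∈ ℤ`.** For `b ∈ bkpts a T`, an admissible scale `η` and the lattice hypothesis:
`L·(germR(δ) η b + germL(δ) η b)` is an integer (`germ_pair_exists_intComb`: `K_b = −Σ c_i·j_i`). -/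
theorem germ_pair_mul_mem_int {a : Dir} (hpos : ∀ k, 0 < h28 a k) {T b : ℝ} (hb : b ∈ bkpts a T)
    (δ : Fin 8 → ℝ) {η : ℝ} (hη : 0 < η) (h1 : η * clusterBound a δ < 1) (h2 : η * clusterBound a δ < wallDist a T)
    {L : ℝ} (hL : ∀ k : Fin 28, ∃ z : ℤ, L * (phiForm δ k / h28 a k) = z) :
    ∃ z : ℤ, L * (germR a δ η b + germL a δ η b) = z := by
  obtain ⟨n, c, j, -, -, -, -, -, hint, -, -, hK⟩ := germ_pair_exists_intComb hpos hb δ hη h1 h2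
  obtain ⟨z, hz⟩ := sum_mul_int_of_lattice j fun i hi0 hin => lattice_of_interior hL (hint i hi0 hin)
  exact ⟨-z, by rw [hK, mul_neg, hz]; push_cast; ring⟩

/-- **`L·R_b(δ) ∈ ℤ`** — the symmetric vote `R_b(δ) = K_b(δ) + K_b(−δ)` lies on the lattice. -/
theorem germ_symm_mul_mem_int {a : Dir} (hpos : ∀ k, 0 < h28 a k) {T b : ℝ} (hb : b ∈ bkpts a T)
    (δ : Fin 8 → ℝ) {η : ℝ} (hη : 0 < η) (h1 : η * clusterBound a δ < 1) (h2 : η * clusterBound a δ < wallDist a T)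
    {L : ℝ} (hL : ∀ k : Fin 28, ∃ z : ℤ, L * (phiForm δ k / h28 a k) = z) :
    ∃ z : ℤ, L * (germR a δ η b + germL a δ η b + germR a (-δ) η b + germL a (-δ) η b) = z := by
  obtain ⟨z₁, hz₁⟩ := germ_pair_mul_mem_int hpos hb δ hη h1 h2 hL
  have h1n : η * clusterBound a (-δ) < 1 := by rw [clusterBound_neg]; exact h1
  have h2n : η * clusterBound a (-δ) < wallDist a T := by rw [clusterBound_neg]; exact h2
  obtain ⟨z₂, hz₂⟩ := germ_pair_mul_mem_int hpos hb (-δ) hη h1n h2n (lattice_neg hL)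
  exact ⟨z₁ + z₂, by push_cast; rw [← hz₁, ← hz₂]; ring⟩

/-- **`L·E(δ) ∈ ℤ`** — the lattice-point push `E(δ) = germR(δ) ρ 0 + germL(δ) ρ T + germR(−δ) ρ 0 + germL(−δ) ρ T`
(a period `T`: the left germ at `T` is the left germ at `0`) lies on the lattice. -/
theorem endGerms_mul_mem_int {a : Dir} (hpos : ∀ k, 0 < h28 a k) {T : ℝ} (hT : 0 < T)
    (hper : ∀ k : Fin 28, ∃ z : ℤ, T * h28 a k = z) (δ : Fin 8 → ℝ) {ρ : ℝ} (hρ : 0 < ρ)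
    (h1 : ρ * clusterBound a δ < 1) (h2 : ρ * clusterBound a δ < wallDist a T)
    {L : ℝ} (hL : ∀ k : Fin 28, ∃ z : ℤ, L * (phiForm δ k / h28 a k) = z) :
    ∃ z : ℤ, L * (germR a δ ρ 0 + germL a δ ρ T + (germR a (-δ) ρ 0 + germL a (-δ) ρ T)) = z := by
  obtain ⟨z, hz⟩ := germ_symm_mul_mem_int hpos (zero_mem_bkpts a hT.le) δ hρ h1 h2 hL
  rw [germL_period hper, germL_period hper]
  exact ⟨z, by rw [← hz]; ring⟩

/-- **THE CUSP SLOPE LIVES ON THE LATTICE: `L·σ(δ) ∈ ℤ`.** For all 28 forms of `a` positive, a period `T` and the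
lattice hypothesis, `L · cuspSlope a T δ` is an integer (`cuspSlope_eq_neg_intComb` at the admissible scale of
`exists_admissible_scale`; the conclusion is scale-free). -/
theorem cuspSlope_mul_mem_int {a : Dir} (hpos : ∀ k, 0 < h28 a k) {T : ℝ} (hT : 0 < T)
    (hper : ∀ k : Fin 28, ∃ z : ℤ, T * h28 a k = z) (δ : Fin 8 → ℝ)
    {L : ℝ} (hL : ∀ k : Fin 28, ∃ z : ℤ, L * (phiForm δ k / h28 a k) = z) :
    ∃ z : ℤ, L * cuspSlope a T δ = z := by
  classical
  obtain ⟨ρ, hρ, h1, h2, hgap⟩ := exists_admissible_scale hpos hT δ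
  obtain ⟨n, c, j, hdata, hσ⟩ := cuspSlope_eq_neg_intComb hpos hT hper δ hρ h1 h2 hgap
  have hm : ∀ m ∈ Finset.range ((bkpts a T).card - 1),
      ∃ z : ℤ, L * ∑ i ∈ Finset.Ico 1 (n m), c m i * (j m i : ℝ) = z := by
    intro m hm
    rw [Finset.mem_range] at hm
    obtain ⟨-, -, -, -, -, hint, -, -⟩ := hdata m (by omega)
    exact sum_mul_int_of_lattice (j m) fun i hi0 hin => lattice_of_interior hL (hint i hi0 hin)
  choose! z hz using hm
  refine ⟨-∑ m ∈ Finset.range ((bkpts a T).card - 1), z m, ?_⟩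
  rw [hσ, mul_neg, Finset.mul_sum, Finset.sum_congr rfl hz]
  push_cast
  ring

/-! ### The gap -/

/-- A lattice number `r ≤ 0` (`L·r ∈ ℤ`, `L > 0`) is `0` or `≤ −1/L`. -/
theorem eq_zero_or_le_neg_inv_of_lattice {L r : ℝ} (hL : 0 < L) (hz : ∃ z : ℤ, L * r = z) (hr : r ≤ 0) :
    r = 0 ∨ r ≤ -1 / L := by
  obtain ⟨z, hz⟩ := hz
  have hz0 : (z : ℝ) ≤ 0 := by rw [← hz]; nlinarith
  rcases eq_or_lt_of_le hz0 with h0 | hneg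
  · left
    have h : L * r = 0 := by rw [hz, h0]
    rcases mul_eq_zero.mp h with h | h
    · exact absurd h hL.ne'
    · exact h
  · right
    have hz1 : (z : ℝ) ≤ -1 := by
      have h : z < 0 := by exact_mod_cast hneg
      have h' : z ≤ -1 := by omega
      exact_mod_cast h'
    rw [le_div_iff₀ hL]
    nlinarith

/-- A lattice number `r ≥ 0` (`L·r ∈ ℤ`, `L > 0`) is `0` or `≥ 1/L`. -/
theorem eq_zero_or_inv_le_of_lattice {L r : ℝ} (hL : 0 < L) (hz : ∃ z : ℤ, L * r = z) (hr : 0 ≤ r) :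
    r = 0 ∨ 1 / L ≤ r := by
  obtain ⟨z, hz⟩ := hz
  have hz0 : 0 ≤ (z : ℝ) := by rw [← hz]; nlinarith
  rcases eq_or_lt_of_le hz0 with h0 | hposz
  · left
    have h : L * r = 0 := by rw [hz, ← h0]
    rcases mul_eq_zero.mp h with h | h
    · exact absurd h hL.ne'
    · exact h
  · right
    have hz1 : 1 ≤ (z : ℝ) := by
      have h : 0 < z := by exact_mod_cast hposz
      have h' : 1 ≤ z := by omega
      exact_mod_cast h'
    rw [div_le_iff₀ hL]
    nlinarith

/-- **THE LATTICE GAP AT A LOCAL MAXIMISER.** At a Regular OPEN-box direction with a period `T` and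
`Q = C₁ + δ₂₈ − Φ > 0` which is a local maximiser of the MODEL `γ` (P2 g23's hypotheses: `σ(δ) ≤ 0` in every
direction), for every displacement `δ` whose 28 flip times lie on the lattice `(1/L)ℤ` (`0 < L`):
**either `cuspSlope a T δ = 0` or `cuspSlope a T δ ≤ −1/L`**. A discrete necessary condition, not a location; the
value of `σ` and of `L` at any named direction stays DATA. -/
theorem cuspSlope_eq_zero_or_le_of_isLocalMax {a : Dir}
    (hopen : ∀ j : Fin 7, 0 < sParam a j.succ ∧ sParam a j.succ < sParam a 0)
    {T : ℝ} (hT : 0 < T) (hper : ∀ k : Fin 28, ∃ z : ℤ, T * h28 a k = z) (δ : Fin 8 → ℝ)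
    (hQ : 0 < C1 a + delta28 a - phi30 a) (hreg : Regular a) (hmax : IsLocalMax gamma a)
    {L : ℝ} (hL0 : 0 < L) (hL : ∀ k : Fin 28, ∃ z : ℤ, L * (phiForm δ k / h28 a k) = z) :
    cuspSlope a T δ = 0 ∨ cuspSlope a T δ ≤ -1 / L :=
  eq_zero_or_le_neg_inv_of_lattice hL0 (cuspSlope_mul_mem_int (h28_pos_of_openBox hopen) hT hper δ hL)
    (cuspSlope_nonpos_of_isLocalMax hopen hT hper δ hQ hreg hmax)

/-- **The lattice-point push is `0` or at least `1/L`** — for EVERY `δ` on the lattice (no maximiser needed):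
`E(δ) ≥ 0` (`endGerms_nonneg`) and `L·E(δ) ∈ ℤ`. -/
theorem endGerms_eq_zero_or_ge {a : Dir} (hpos : ∀ k, 0 < h28 a k) {T : ℝ} (hT : 0 < T)
    (hper : ∀ k : Fin 28, ∃ z : ℤ, T * h28 a k = z) (δ : Fin 8 → ℝ) {ρ : ℝ} (hρ : 0 < ρ)
    (h1 : ρ * clusterBound a δ < 1) (h2 : ρ * clusterBound a δ < wallDist a T)
    {L : ℝ} (hL0 : 0 < L) (hL : ∀ k : Fin 28, ∃ z : ℤ, L * (phiForm δ k / h28 a k) = z) :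
    germR a δ ρ 0 + germL a δ ρ T + (germR a (-δ) ρ 0 + germL a (-δ) ρ T) = 0 ∨
      1 / L ≤ germR a δ ρ 0 + germL a δ ρ T + (germR a (-δ) ρ 0 + germL a (-δ) ρ T) :=
  eq_zero_or_inv_le_of_lattice hL0 (endGerms_mul_mem_int hpos hT hper δ hρ h1 h2 hL)
    (endGerms_nonneg hpos hper δ hρ.le h1)

/-! ### Integer forms: `L = lcm_k h_k` -/

/-- The pair forms of an integer vector are integers. -/
theorem pairForm_realDir_eq_int (d : Fin 8 → ℤ) (i j : Fin 8) : ∃ z : ℤ, pairForm (realDir d) i j = z := by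
  unfold pairForm realDir
  split_ifs
  · exact ⟨d 0 - d j, by push_cast; rfl⟩
  · exact ⟨d 0 - d i, by push_cast; rfl⟩
  · exact ⟨d i + d j, by push_cast; rfl⟩

/-- The 28 forms `φ_k` of an integer vector are integers. -/
theorem phiForm_realDir_eq_int (d : Fin 8 → ℤ) (k : Fin 28) : ∃ z : ℤ, phiForm (realDir d) k = z := by
  rw [phiForm_eq]; exact pairForm_realDir_eq_int d _ _

/-- For integer forms `h_k(a) = f k` (all positive) the least common multiple `lcm_k f k` is positive. -/
theorem lcm_forms_pos {a : Dir} (hpos : ∀ k, 0 < h28 a k) {f : Fin 28 → ℤ} (hf : ∀ k, (f k : ℝ) = h28 a k) :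
    0 < Finset.univ.lcm f := by
  have hnn : 0 ≤ Finset.univ.lcm f := Int.nonneg_of_normalize_eq_self Finset.normalize_lcm
  have hne : Finset.univ.lcm f ≠ 0 := by
    intro h
    obtain ⟨k, -, hk⟩ := Finset.lcm_eq_zero_iff.mp h
    have h' := hpos k
    rw [← hf k, hk] at h'
    simp at h'
  exact lt_of_le_of_ne hnn (Ne.symm hne)

/-- **INTEGER FORMS GIVE THE LATTICE `(1/lcm)ℤ`.** If the 28 forms of `a` are positive integers `f k` and the 28 forms
`φ_k(δ)` of the displacement are integers, then `L = lcm_k f k` satisfies the lattice hypothesis: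
`L·φ_k(δ)/h_k(a) = φ_k(δ)·(L/f k) ∈ ℤ`. -/
theorem lattice_of_int_forms {a : Dir} (hpos : ∀ k, 0 < h28 a k) {f : Fin 28 → ℤ} (hf : ∀ k, (f k : ℝ) = h28 a k)
    {δ : Fin 8 → ℝ} (hδ : ∀ k, ∃ z : ℤ, phiForm δ k = z) (k : Fin 28) :
    ∃ z : ℤ, ((Finset.univ.lcm f : ℤ) : ℝ) * (phiForm δ k / h28 a k) = z := by
  obtain ⟨q, hq⟩ := Finset.dvd_lcm (f := f) (Finset.mem_univ k)
  obtain ⟨w, hw⟩ := hδ k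
  have hk0 : (f k : ℝ) ≠ 0 := by rw [hf]; exact (hpos k).ne'
  refine ⟨q * w, ?_⟩
  rw [hq, hw, ← hf]
  push_cast
  field_simp

/-- **Integer direction, integer displacement**: for `a = realDir a₀` with positive forms and `δ = realDir d`,
`L = lcm_k h_k(a₀)` satisfies the lattice hypothesis. -/
theorem lattice_hyp_of_realDir (a₀ d : Fin 8 → ℤ) (hpos : ∀ k, 0 < h28 (realDir a₀) k) (k : Fin 28) :
    ∃ z : ℤ, ((Finset.univ.lcm fun k : Fin 28 => hForm a₀ (k + 1) : ℤ) : ℝ) *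
      (phiForm (realDir d) k / h28 (realDir a₀) k) = z :=
  lattice_of_int_forms hpos (fun k => (h28_realDir a₀ k).symm) (phiForm_realDir_eq_int d) k

/-- **`(lcm_k h_k)·σ(δ) ∈ ℤ` for integer forms**: if the 28 forms of `a` are positive integers `f k`, `T` is a period
and the displacement has integer forms `φ_k(δ)`, then `(lcm_k f k) · cuspSlope a T δ` is an integer. -/
theorem cuspSlope_mul_lcm_mem_int {a : Dir} (hpos : ∀ k, 0 < h28 a k) {f : Fin 28 → ℤ}
    (hf : ∀ k, (f k : ℝ) = h28 a k) {T : ℝ} (hT : 0 < T) (hper : ∀ k : Fin 28, ∃ z : ℤ, T * h28 a k = z)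
    {δ : Fin 8 → ℝ} (hδ : ∀ k, ∃ z : ℤ, phiForm δ k = z) :
    ∃ z : ℤ, ((Finset.univ.lcm f : ℤ) : ℝ) * cuspSlope a T δ = z :=
  cuspSlope_mul_mem_int hpos hT hper δ (lattice_of_int_forms hpos hf hδ)

/-- **INTEGER DIRECTION, INTEGER DISPLACEMENT.** For an integer parameter vector `a₀` with all 28 forms positive
(period `T = 1`) and an integer displacement `d`: `(lcm_k h_k(a₀)) · cuspSlope (realDir a₀) 1 (realDir d) ∈ ℤ`.
Rational displacements reduce to this by `cuspSlope_smul`; so at such a direction the cusp slope takes values in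
`(1/lcm_k h_k(a₀))ℤ` on integer displacements, and at a local maximiser of the MODEL `γ` it is `0` or
`≤ −1/lcm_k h_k(a₀)` there (`cuspSlope_eq_zero_or_le_of_isLocalMax`). -/
theorem cuspSlope_realDir_mul_lcm_mem_int (a₀ d : Fin 8 → ℤ) (hpos : ∀ k, 0 < h28 (realDir a₀) k) :
    ∃ z : ℤ, ((Finset.univ.lcm fun k : Fin 28 => hForm a₀ (k + 1) : ℤ) : ℝ) *
      cuspSlope (realDir a₀) 1 (realDir d) = z :=
  cuspSlope_mul_lcm_mem_int hpos (fun k => (h28_realDir a₀ k).symm) one_pos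
    (fun k => ⟨hForm a₀ (k + 1), by rw [one_mul, h28_realDir]⟩) (phiForm_realDir_eq_int d)

/-- **THE GAP AT AN INTEGER DIRECTION.** At an integer parameter vector `a₀` in the OPEN box which is Regular with
`Q > 0` and a local maximiser of the MODEL `γ`, for every integer displacement `d`:
`σ(d) = 0 ∨ σ(d) ≤ −1/lcm_k h_k(a₀)` (period `1`). -/
theorem cuspSlope_realDir_eq_zero_or_le_of_isLocalMax (a₀ d : Fin 8 → ℤ)
    (hopen : ∀ j : Fin 7, 0 < sParam (realDir a₀) j.succ ∧ sParam (realDir a₀) j.succ < sParam (realDir a₀) 0)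
    (hQ : 0 < C1 (realDir a₀) + delta28 (realDir a₀) - phi30 (realDir a₀)) (hreg : Regular (realDir a₀))
    (hmax : IsLocalMax gamma (realDir a₀)) :
    cuspSlope (realDir a₀) 1 (realDir d) = 0 ∨
      cuspSlope (realDir a₀) 1 (realDir d) ≤
        -1 / ((Finset.univ.lcm fun k : Fin 28 => hForm a₀ (k + 1) : ℤ) : ℝ) := by
  have hpos := h28_pos_of_openBox hopen
  have hf : ∀ k, ((fun k : Fin 28 => hForm a₀ (k + 1)) k : ℝ) = h28 (realDir a₀) k :=
    fun k => (h28_realDir a₀ k).symm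
  exact cuspSlope_eq_zero_or_le_of_isLocalMax hopen one_pos (fun k => ⟨hForm a₀ (k + 1), by rw [one_mul, h28_realDir]⟩)
    (realDir d) hQ hreg hmax (by exact_mod_cast lcm_forms_pos hpos hf)
    (lattice_of_int_forms hpos hf (phiForm_realDir_eq_int d))

end Summit.KontsevichZagierPeriods.Zeta5Search.Barrier.ConeGamma

end
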